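import Summits.SmoothPoincare4.SmoothPoincare4.Theorems.CylinderEntropySliceIsolationStubCertMidLow2
import Mathlib
import HarnessLib

/-!
# Three-atom certificates for the conformal kernel domination: generic tools (stub `stub_certMidLow3`)

Helper file for the line `conformal-kernel-domination` of the crux
`Summit.SmoothPoincare4.SmoothPoincare4.Theses.CylinderEntropy.SliceIsolation` (crux item
stmt-SmoothPoincare4-7632).  Notation as in `CylinderEntropySliceIsolationStubCertMidLow2.lean`:
`pulled(T,u,s) = (8π²/3)((4πT)²)⁻¹ e^{4u} e^{−Q/4T}`, `Q = (eᵘ − 1)² + 2eᵘ(1 − s)`, and a broadened on-axis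
cylinder ("zonal") atom `w · 𝔥(kT, s) · e^{−(u−σ)²/(4kT)}` is minorised through Cheeger–Yau by
`(w/k²)(8π²/3)((4πT)²)⁻¹ e^{−(arccos(s)² + (u−σ)²)/(4kT)}`.

The new tool of this file is the **softmax (Gibbs variational) blending rule** `certMidLow3_rule`: a SUM of
three atoms plus an area atom dominates `pulled` at a point as soon as, for some probability vector
`(λ₀, λ₁, λ₂, λ₃)`, the exponent of `pulled` is below the `λ`-average of the exponents of the four minorants
plus the entropy `−Σ λᵢ log λᵢ` (Jensen for `exp`); with `λ` frozen on a box this is ONE polynomial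
inequality, which is how the certificates of `stub_certMidLow3` are checked box by box.  Also here: an
angular comparison `arccos(s)²(1 − t²/24)² ≤ 2(1 − s)` on `s ≥ 1 − (t²/2)(1 − t²/24)²` (from
`sin x ≥ x − x³/6`), secant/tangent enclosures of `u = log r` on an `r`-cell, a Taylor enclosure of `exp`
for the numerical constants, and a parametrised far-region bound.
-/

noncomputable section

-- the registered namespace `Summit.SmoothPoincare4.SmoothPoincare4.Theorems…` repeats a component
set_option linter.dupNamespace false

namespace Summit.SmoothPoincare4.SmoothPoincare4.Theorems.CylinderEntropySliceIsolation

open Literature.Geometry.Riemannian Literature.Geometry.Riemannian.SphericalCylinderEntropy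

/-- Taylor enclosure of `exp x` for `|x| ≤ 1` with twelve terms (`Real.exp_bound`), in a form whose two
numerical side conditions are decided by `norm_num`. [folklore] -/
theorem certMidLow3_exp_encl {x lo hi : ℝ} (hx : |x| ≤ 1)
    (hlo : lo ≤ 1 + x + x ^ 2 / 2 + x ^ 3 / 6 + x ^ 4 / 24 + x ^ 5 / 120 + x ^ 6 / 720 + x ^ 7 / 5040 +
      x ^ 8 / 40320 + x ^ 9 / 362880 + x ^ 10 / 3628800 + x ^ 11 / 39916800 -
      |x| ^ 12 * (13 / (479001600 * 12)))
    (hhi : 1 + x + x ^ 2 / 2 + x ^ 3 / 6 + x ^ 4 / 24 + x ^ 5 / 120 + x ^ 6 / 720 + x ^ 7 / 5040 +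
      x ^ 8 / 40320 + x ^ 9 / 362880 + x ^ 10 / 3628800 + x ^ 11 / 39916800 +
      |x| ^ 12 * (13 / (479001600 * 12)) ≤ hi) :
    lo ≤ Real.exp x ∧ Real.exp x ≤ hi := by
  have h := Real.exp_bound hx (n := 12) (by norm_num)
  have hs : ∑ m ∈ Finset.range 12, x ^ m / (m.factorial : ℝ) = 1 + x + x ^ 2 / 2 + x ^ 3 / 6 + x ^ 4 / 24 +
      x ^ 5 / 120 + x ^ 6 / 720 + x ^ 7 / 5040 + x ^ 8 / 40320 + x ^ 9 / 362880 + x ^ 10 / 3628800 +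
      x ^ 11 / 39916800 := by
    simp [Finset.sum_range_succ, Nat.factorial]
  rw [hs] at h
  norm_num at h hlo hhi ⊢
  constructor
  · linarith [(abs_le.1 h).1]
  · linarith [(abs_le.1 h).2]

/-- `exp x = (exp (x / n))ⁿ`, to push the enclosure beyond `|x| ≤ 1`. [folklore] -/
theorem certMidLow3_exp_eq_pow (x : ℝ) (n : ℕ) (hn : n ≠ 0) : Real.exp x = Real.exp (x / n) ^ n := by
  rw [← Real.exp_nat_mul]; congr 1; field_simp

/-- Tangent enclosure of the height: if `ρ ≤ e^l` (`ρ > 0`, `IR·ρ = 1`) then `u ≤ l + IR·(eᵘ − ρ)`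
(`u − l ≤ e^{u−l} − 1 ≤ eᵘ/ρ − 1`). [folklore] -/
theorem certMidLow3_u_le {u ρ l IR : ℝ} (hρ : 0 < ρ) (hl : ρ ≤ Real.exp l) (hIR : IR * ρ = 1) :
    u ≤ l + IR * (Real.exp u - ρ) := by
  have h1 : u - l ≤ Real.exp (u - l) - 1 := by linarith [Real.add_one_le_exp (u - l)]
  have h2 : Real.exp (u - l) ≤ Real.exp u / ρ := by
    rw [Real.exp_sub]
    exact div_le_div_of_nonneg_left (Real.exp_pos u).le hρ hl
  have h3 : Real.exp u / ρ - 1 = IR * (Real.exp u - ρ) := by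
    have : IR = 1 / ρ := by rw [eq_div_iff hρ.ne']; exact hIR
    rw [this]; field_simp
  linarith

/-- Secant enclosure of the height on an `r`-cell: if `e^{la} ≤ a ≤ eᵘ ≤ b`, `e^{lb} ≤ b` and
`SL·(b − a) = lb − la` then `la + SL·(eᵘ − a) ≤ u` (concavity of `log`). [folklore] -/
theorem certMidLow3_le_u {u a b la lb SL : ℝ} (ha : 0 < a) (hab : a < b) (hla : Real.exp la ≤ a)
    (hlb : Real.exp lb ≤ b) (hSL : SL * (b - a) = lb - la) (h1 : a ≤ Real.exp u) (h2 : Real.exp u ≤ b) :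
    la + SL * (Real.exp u - a) ≤ u := by
  have hb : 0 < b := ha.trans hab
  have hla' : la ≤ Real.log a := by rw [Real.le_log_iff_exp_le ha]; exact hla
  have hlb' : lb ≤ Real.log b := by rw [Real.le_log_iff_exp_le hb]; exact hlb
  set t : ℝ := (Real.exp u - a) / (b - a) with ht
  have hba : 0 < b - a := by linarith
  have ht0 : 0 ≤ t := div_nonneg (by linarith) hba.le
  have ht1 : t ≤ 1 := by rw [ht, div_le_one hba]; linarith
  have hconc := (strictConcaveOn_log_Ioi.concaveOn).2 (Set.mem_Ioi.2 ha) (Set.mem_Ioi.2 hb)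
    (show (0 : ℝ) ≤ 1 - t by linarith) ht0 (by ring)
  simp only [smul_eq_mul] at hconc
  have hr : (1 - t) * a + t * b = Real.exp u := by rw [ht]; field_simp; ring
  rw [hr, Real.log_exp] at hconc
  have hSL' : SL * (Real.exp u - a) = (lb - la) * t := by
    rw [ht, mul_div_assoc', eq_div_iff hba.ne', ← hSL]; ring
  rw [hSL']
  nlinarith [mul_le_mul_of_nonneg_left hla' (show (0 : ℝ) ≤ 1 - t by linarith),
    mul_le_mul_of_nonneg_left hlb' ht0]

/-- **Angular comparison.** If `0 ≤ t`, `t² ≤ 24`, `1 − (t²/2)(1 − t²/24)² ≤ s₀ ≤ s ≤ 1` then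
`arccos(s)² (1 − t²/24)² ≤ 2(1 − s)`: with `θ = arccos s` one has `θ ≤ t` (as `cos` is decreasing on
`[0, π]` and `cos t = 1 − 2 sin²(t/2) ≤ 1 − (t²/2)(1 − t²/24)²`), and
`1 − s = 2 sin²(θ/2) ≥ 2(θ/2 − θ³/48)² = (θ²/2)(1 − θ²/24)² ≥ (θ²/2)(1 − t²/24)²`
(`Real.sin_ge_sub_cube`). [folklore] -/
theorem certMidLow3_ang {s s₀ t : ℝ} (hs1 : -1 ≤ s) (hs2 : s ≤ 1) (ht0 : 0 ≤ t) (ht24 : t ^ 2 ≤ 24) (hs₀ : 1 - t ^ 2 / 2 * (1 - t ^ 2 / 24) ^ 2 ≤ s₀) (hss : s₀ ≤ s) :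
    Real.arccos s ^ 2 * (1 - t ^ 2 / 24) ^ 2 ≤ 2 * (1 - s) := by
  -- `1 - cos x = 2 sin²(x/2) ≥ (x²/2)(1 - x²/24)²` for `0 ≤ x`, `x² ≤ 24`
  have key : ∀ x : ℝ, 0 ≤ x → x ^ 2 ≤ 24 → x ^ 2 / 2 * (1 - x ^ 2 / 24) ^ 2 ≤ 1 - Real.cos x := by
    intro x hx0 hx24
    have h1 : 1 - Real.cos x = 2 * Real.sin (x / 2) ^ 2 := by
      rw [Real.sin_sq_eq_half_sub, show 2 * (x / 2) = x by ring]; ring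
    have h2 : x / 2 - (x / 2) ^ 3 / 6 ≤ Real.sin (x / 2) := Real.sin_ge_sub_cube (by linarith)
    have h3 : 0 ≤ x / 2 - (x / 2) ^ 3 / 6 := by
      have : (x / 2) ^ 3 / 6 = x / 2 * (x ^ 2 / 24) := by ring
      rw [this]; nlinarith
    have h4 := pow_le_pow_left₀ h3 h2 2
    calc x ^ 2 / 2 * (1 - x ^ 2 / 24) ^ 2 = 2 * (x / 2 - (x / 2) ^ 3 / 6) ^ 2 := by ring
      _ ≤ 2 * Real.sin (x / 2) ^ 2 := by linarith
      _ = 1 - Real.cos x := h1.symm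
  set θ := Real.arccos s with hθ
  have hθ0 : 0 ≤ θ := Real.arccos_nonneg s
  have hθπ : θ ≤ Real.pi := Real.arccos_le_pi s
  have hcos : Real.cos θ = s := Real.cos_arccos hs1 hs2
  -- `θ ≤ t`
  have hθt : θ ≤ t := by
    by_contra hcon
    push Not at hcon
    have hlt : Real.cos θ < Real.cos t := Real.cos_lt_cos_of_nonneg_of_le_pi ht0 hθπ hcon
    have hct : Real.cos t ≤ s₀ := by linarith [key t ht0 ht24]
    linarith
  have hθ2 : θ ^ 2 ≤ t ^ 2 := pow_le_pow_left₀ hθ0 hθt 2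
  have hθ24 : θ ^ 2 ≤ 24 := hθ2.trans ht24
  have hk := key θ hθ0 hθ24
  rw [hcos] at hk
  have hA : 0 ≤ 1 - t ^ 2 / 24 := by nlinarith
  have hB : 1 - t ^ 2 / 24 ≤ 1 - θ ^ 2 / 24 := by linarith
  have hsq : (1 - t ^ 2 / 24) ^ 2 ≤ (1 - θ ^ 2 / 24) ^ 2 := pow_le_pow_left₀ hA hB 2
  calc θ ^ 2 * (1 - t ^ 2 / 24) ^ 2 ≤ θ ^ 2 * (1 - θ ^ 2 / 24) ^ 2 :=
        mul_le_mul_of_nonneg_left hsq (sq_nonneg θ)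
    _ = 2 * (θ ^ 2 / 2 * (1 - θ ^ 2 / 24) ^ 2) := by ring
    _ ≤ 2 * (1 - s) := by linarith

/-- `λ e^{Y − log λ} ≤ e^{Y}` for `λ ≥ 0` (equality if `λ > 0`, and `0 ≤ e^Y` if `λ = 0`). [folklore] -/
theorem certMidLow3_term {l Y : ℝ} (hl : 0 ≤ l) : l * Real.exp (Y - Real.log l) ≤ Real.exp Y := by
  rcases hl.eq_or_lt with h | h
  · rw [← h]; simp [Real.exp_nonneg]
  · rw [Real.exp_sub, Real.exp_log h]; field_simp; rfl

/-- **Softmax blending (Jensen for `exp`).** For a probability vector `(λ₀, …, λ₃)` and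
`Hc ≤ −Σ λᵢ log λᵢ`: `exp(Hc + Σ λᵢ Yᵢ) ≤ Σ exp Yᵢ`. [folklore] -/
theorem certMidLow3_lse {Hc l0 l1 l2 l3 Y0 Y1 Y2 Y3 : ℝ} (h0 : 0 ≤ l0) (h1 : 0 ≤ l1) (h2 : 0 ≤ l2)
    (h3 : 0 ≤ l3) (hsum : l0 + l1 + l2 + l3 = 1)
    (hH : Hc ≤ -(l0 * Real.log l0 + l1 * Real.log l1 + l2 * Real.log l2 + l3 * Real.log l3)) :
    Real.exp (Hc + (l0 * Y0 + l1 * Y1 + l2 * Y2 + l3 * Y3)) ≤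
      Real.exp Y0 + Real.exp Y1 + Real.exp Y2 + Real.exp Y3 := by
  have hJ := (convexOn_exp).map_sum_le (t := Finset.univ) (w := ![l0, l1, l2, l3])
    (p := ![Y0 - Real.log l0, Y1 - Real.log l1, Y2 - Real.log l2, Y3 - Real.log l3])
    (by intro i _; fin_cases i <;> simpa) (by simp [Fin.sum_univ_four, hsum]) (by intro i _; simp)
  simp only [Fin.sum_univ_four, smul_eq_mul] at hJ
  simp only [Matrix.cons_val_zero, Matrix.cons_val_one, Matrix.cons_val] at hJ
  calc Real.exp (Hc + (l0 * Y0 + l1 * Y1 + l2 * Y2 + l3 * Y3))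
      ≤ Real.exp (l0 * (Y0 - Real.log l0) + l1 * (Y1 - Real.log l1) + l2 * (Y2 - Real.log l2) +
          l3 * (Y3 - Real.log l3)) := Real.exp_le_exp.2 (by linarith)
    _ ≤ l0 * Real.exp (Y0 - Real.log l0) + l1 * Real.exp (Y1 - Real.log l1) +
          l2 * Real.exp (Y2 - Real.log l2) + l3 * Real.exp (Y3 - Real.log l3) := hJ
    _ ≤ Real.exp Y0 + Real.exp Y1 + Real.exp Y2 + Real.exp Y3 := by
        linarith [certMidLow3_term (Y := Y0) h0, certMidLow3_term (Y := Y1) h1,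
          certMidLow3_term (Y := Y2) h2, certMidLow3_term (Y := Y3) h3]

/-- **One broadened atom (core estimate).** At scale `kT`, Cheeger–Yau and
`(8π²/3)(4πT)⁻² = k²(8π²/3)(4πkT)⁻²` give
`(8π²/3)(4πT)⁻² e^{ℓ − (θ² + (u−σ)²)/(4kT)} ≤ k² e^ℓ · 𝔥(kT, s) e^{−(u−σ)²/(4kT)}`. [folklore] -/
theorem certMidLow3_core {T k ℓ w u σ s : ℝ} (hT : 0 < T) (hk : 0 < k) (hs1 : -1 ≤ s) (hs2 : s ≤ 1)
    (hw : k ^ 2 * Real.exp ℓ = w) :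
    (8 * Real.pi ^ 2 / 3) * ((4 * Real.pi * T) ^ 2)⁻¹ *
        Real.exp (ℓ + (-(Real.arccos s) ^ 2 / (4 * (k * T)) + -(u - σ) ^ 2 / (4 * (k * T)))) ≤
      w * (zonal (k * T) s * Real.exp (-(u - σ) ^ 2 / (4 * (k * T)))) := by
  have hτ0 : 0 < k * T := mul_pos hk hT
  have hCY := CheegerYauZonalSphereFour_holds (k * T) hτ0 s hs1 hs2
  have hpref : (8 * Real.pi ^ 2 / 3) * ((4 * Real.pi * T) ^ 2)⁻¹ =
      k ^ 2 * ((8 * Real.pi ^ 2 / 3) * ((4 * Real.pi * (k * T)) ^ 2)⁻¹) := by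
    have hTne : T ≠ 0 := hT.ne'
    have hkne : k ≠ 0 := hk.ne'
    have hπ : Real.pi ≠ 0 := Real.pi_ne_zero
    field_simp
  rw [← hw, hpref, Real.exp_add, Real.exp_add]
  calc k ^ 2 * ((8 * Real.pi ^ 2 / 3) * ((4 * Real.pi * (k * T)) ^ 2)⁻¹) * (Real.exp ℓ *
        (Real.exp (-(Real.arccos s) ^ 2 / (4 * (k * T))) * Real.exp (-(u - σ) ^ 2 / (4 * (k * T)))))
      = k ^ 2 * Real.exp ℓ * (((8 * Real.pi ^ 2 / 3) * ((4 * Real.pi * (k * T)) ^ 2)⁻¹ *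
          Real.exp (-(Real.arccos s) ^ 2 / (4 * (k * T)))) * Real.exp (-(u - σ) ^ 2 / (4 * (k * T)))) := by
        ring
    _ ≤ k ^ 2 * Real.exp ℓ * (zonal (k * T) s * Real.exp (-(u - σ) ^ 2 / (4 * (k * T)))) := by gcongr

/-- **The blending rule.** Three broadened atoms `(kⱼ, σⱼ, ℓⱼ, wⱼ = kⱼ² e^{ℓⱼ})` and an area atom
`c = (8π²/3)(4πT)⁻² e^{log(6T²c)}`; if for a probability vector `(λ₀, λ₁, λ₂, λ₃)`, an entropy minorant
`Hc ≤ −Σλᵢ log λᵢ` and a minorant `L ≤ log(6T²c)` the exponent comparison (cleared of denominators)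
`k₁k₂k₃(16Tu − Q) ≤ 4Tk₁k₂k₃(Hc + λ₀L + Σλⱼℓⱼ) − Σⱼ λⱼ (Πᵢ≠ⱼ kᵢ)(arccos(s)² + (u − σⱼ)²)` holds, then
`pulled ≤ Σ wⱼ 𝔥(kⱼT, s) e^{−(u−σⱼ)²/(4kⱼT)} + c` at `(u, s)` (Jensen, then Cheeger–Yau termwise). [folklore] -/
theorem certMidLow3_rule {T u s Q c L Hc l0 l1 l2 l3 k₁ σ₁ ℓ₁ w₁ k₂ σ₂ ℓ₂ w₂ k₃ σ₃ ℓ₃ w₃ : ℝ}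
    (hT : 0 < T) (hk₁ : 0 < k₁) (hk₂ : 0 < k₂) (hk₃ : 0 < k₃) (hs1 : -1 ≤ s) (hs2 : s ≤ 1)
    (hw₁ : k₁ ^ 2 * Real.exp ℓ₁ = w₁) (hw₂ : k₂ ^ 2 * Real.exp ℓ₂ = w₂) (hw₃ : k₃ ^ 2 * Real.exp ℓ₃ = w₃)
    (hc : 0 < c) (hL : L ≤ Real.log (6 * T ^ 2 * c))
    (h0 : 0 ≤ l0) (h1 : 0 ≤ l1) (h2 : 0 ≤ l2) (h3 : 0 ≤ l3) (hsum : l0 + l1 + l2 + l3 = 1)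
    (hH : Hc ≤ -(l0 * Real.log l0 + l1 * Real.log l1 + l2 * Real.log l2 + l3 * Real.log l3))
    (hpoly : k₁ * k₂ * k₃ * (16 * T * u - Q) ≤
      4 * T * k₁ * k₂ * k₃ * (Hc + l0 * L + l1 * ℓ₁ + l2 * ℓ₂ + l3 * ℓ₃) -
        l1 * k₂ * k₃ * (Real.arccos s ^ 2 + (u - σ₁) ^ 2) -
        l2 * k₁ * k₃ * (Real.arccos s ^ 2 + (u - σ₂) ^ 2) -
        l3 * k₁ * k₂ * (Real.arccos s ^ 2 + (u - σ₃) ^ 2)) :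
    (8 * Real.pi ^ 2 / 3) * ((4 * Real.pi * T) ^ 2)⁻¹ * Real.exp (4 * u) * Real.exp (-Q / (4 * T)) ≤
      w₁ * (zonal (k₁ * T) s * Real.exp (-(u - σ₁) ^ 2 / (4 * (k₁ * T)))) +
        w₂ * (zonal (k₂ * T) s * Real.exp (-(u - σ₂) ^ 2 / (4 * (k₂ * T)))) +
        w₃ * (zonal (k₃ * T) s * Real.exp (-(u - σ₃) ^ 2 / (4 * (k₃ * T)))) + c := by
  set θ2 : ℝ := Real.arccos s ^ 2 with hθ2
  set X₁ : ℝ := -(Real.arccos s) ^ 2 / (4 * (k₁ * T)) + -(u - σ₁) ^ 2 / (4 * (k₁ * T)) with hX₁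
  set X₂ : ℝ := -(Real.arccos s) ^ 2 / (4 * (k₂ * T)) + -(u - σ₂) ^ 2 / (4 * (k₂ * T)) with hX₂
  set X₃ : ℝ := -(Real.arccos s) ^ 2 / (4 * (k₃ * T)) + -(u - σ₃) ^ 2 / (4 * (k₃ * T)) with hX₃
  set pref : ℝ := (8 * Real.pi ^ 2 / 3) * ((4 * Real.pi * T) ^ 2)⁻¹ with hpref
  have hpref0 : 0 < pref := by positivity
  have hTne : T ≠ 0 := hT.ne'
  -- the exponent comparison, denominators restored
  have hkey : 4 * u + -Q / (4 * T) ≤ Hc + (l0 * L + l1 * (ℓ₁ + X₁) + l2 * (ℓ₂ + X₂) + l3 * (ℓ₃ + X₃)) := by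
    have hpos : 0 < 4 * T * k₁ * k₂ * k₃ := by positivity
    rw [← sub_nonneg]
    have hid : Hc + (l0 * L + l1 * (ℓ₁ + X₁) + l2 * (ℓ₂ + X₂) + l3 * (ℓ₃ + X₃)) - (4 * u + -Q / (4 * T)) =
        (4 * T * k₁ * k₂ * k₃ * (Hc + l0 * L + l1 * ℓ₁ + l2 * ℓ₂ + l3 * ℓ₃) -
          l1 * k₂ * k₃ * (Real.arccos s ^ 2 + (u - σ₁) ^ 2) -
          l2 * k₁ * k₃ * (Real.arccos s ^ 2 + (u - σ₂) ^ 2) -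
          l3 * k₁ * k₂ * (Real.arccos s ^ 2 + (u - σ₃) ^ 2) -
          k₁ * k₂ * k₃ * (16 * T * u - Q)) / (4 * T * k₁ * k₂ * k₃) := by
      rw [hX₁, hX₂, hX₃]
      field_simp
      ring
    rw [hid]
    exact div_nonneg (by linarith) hpos.le
  -- Jensen
  have hlse := certMidLow3_lse (Y0 := L) (Y1 := ℓ₁ + X₁) (Y2 := ℓ₂ + X₂) (Y3 := ℓ₃ + X₃) h0 h1 h2 h3 hsum hH
  have hE : Real.exp (4 * u) * Real.exp (-Q / (4 * T)) ≤
      Real.exp L + Real.exp (ℓ₁ + X₁) + Real.exp (ℓ₂ + X₂) + Real.exp (ℓ₃ + X₃) := by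
    rw [← Real.exp_add]
    exact (Real.exp_le_exp.2 hkey).trans hlse
  -- the area atom
  have hcL : pref * Real.exp L ≤ c := by
    have h6 : 0 < 6 * T ^ 2 * c := by positivity
    calc pref * Real.exp L ≤ pref * Real.exp (Real.log (6 * T ^ 2 * c)) := by gcongr
      _ = c := by
          rw [Real.exp_log h6, hpref]
          have hπ : Real.pi ≠ 0 := Real.pi_ne_zero
          field_simp
          ring
  have hA₁ := certMidLow3_core (ℓ := ℓ₁) (u := u) (σ := σ₁) hT hk₁ hs1 hs2 hw₁
  have hA₂ := certMidLow3_core (ℓ := ℓ₂) (u := u) (σ := σ₂) hT hk₂ hs1 hs2 hw₂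
  have hA₃ := certMidLow3_core (ℓ := ℓ₃) (u := u) (σ := σ₃) hT hk₃ hs1 hs2 hw₃
  rw [← hpref, ← hX₁] at hA₁
  rw [← hpref, ← hX₂] at hA₂
  rw [← hpref, ← hX₃] at hA₃
  calc pref * Real.exp (4 * u) * Real.exp (-Q / (4 * T))
      = pref * (Real.exp (4 * u) * Real.exp (-Q / (4 * T))) := by ring
    _ ≤ pref * (Real.exp L + Real.exp (ℓ₁ + X₁) + Real.exp (ℓ₂ + X₂) + Real.exp (ℓ₃ + X₃)) :=
        mul_le_mul_of_nonneg_left hE hpref0.le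
    _ = pref * Real.exp (ℓ₁ + X₁) + pref * Real.exp (ℓ₂ + X₂) + pref * Real.exp (ℓ₃ + X₃) +
          pref * Real.exp L := by ring
    _ ≤ _ := by gcongr

/-- `C x² ≤ eˣ` for `x ≥ x₀` as soon as `x₀ ≥ 2` and `C x₀² ≤ e^{x₀}` (`C ≥ 0`): with `x = x₀ + y`,
`C(x₀ + y)² ≤ e^{x₀}(1 + y + y²/2) ≤ e^{x₀} e^{y}`. [folklore] -/
theorem certMidLow3_sq_le_exp {C x₀ x : ℝ} (hC : 0 ≤ C) (hx₀ : 2 ≤ x₀) (hE : C * x₀ ^ 2 ≤ Real.exp x₀)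
    (hx : x₀ ≤ x) : C * x ^ 2 ≤ Real.exp x := by
  obtain ⟨y, hy0, rfl⟩ : ∃ y : ℝ, 0 ≤ y ∧ x = x₀ + y := ⟨x - x₀, by linarith, by ring⟩
  rw [Real.exp_add]
  have hE0 : 0 ≤ Real.exp x₀ := (Real.exp_pos _).le
  have h1 : 2 * C * x₀ ≤ Real.exp x₀ := by nlinarith
  have h2 : C ≤ Real.exp x₀ / 2 := by
    rw [le_div_iff₀ (by norm_num : (0 : ℝ) < 2)]; nlinarith
  calc C * (x₀ + y) ^ 2 = C * x₀ ^ 2 + 2 * C * x₀ * y + C * y ^ 2 := by ring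
    _ ≤ Real.exp x₀ * (1 + y + y ^ 2 / 2) := by
        have := mul_le_mul_of_nonneg_right h1 hy0
        have := mul_le_mul_of_nonneg_right h2 (sq_nonneg y)
        nlinarith
    _ ≤ Real.exp x₀ * Real.exp y :=
        mul_le_mul_of_nonneg_left (Real.quadratic_le_exp_of_nonneg hy0) hE0

/-- **Far region, parametrised.** If `0 < T ≤ T₂`, `(eᵘ − 1)² ≤ Q`, `q₀ < Q` and the two numerical
conditions `(128/(3c₀q₀²))·x₀² ≤ e^{x₀}` at `x₀ = q₀/(4T₂) ≥ 2` and `(128/(3c₀))·25² ≤ e^{25}`,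
`25 ≤ 1/(4T₂)` hold, then `(1/(6T²)) e^{4u} e^{−Q/4T} ≤ c₀`: for `eᵘ ≤ 2` use `e^{4u} ≤ 16` and
`x = q₀/(4T) ≥ x₀`; for `eᵘ > 2` use `Q ≥ e^{2u}/4` and `z = e^{2u}/(16T) ≥ 25`. [folklore] -/
theorem certMidLow3_far {T T₂ u Q q₀ c₀ : ℝ} (hT : 0 < T) (hT₂ : T ≤ T₂) (hc₀ : 0 < c₀) (hq₀ : 0 < q₀)
    (hQ1 : (Real.exp u - 1) ^ 2 ≤ Q) (hQ2 : q₀ < Q)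
    (hx₀ : 2 ≤ q₀ / (4 * T₂)) (hE₁ : 128 / (3 * c₀ * q₀ ^ 2) * (q₀ / (4 * T₂)) ^ 2 ≤ Real.exp (q₀ / (4 * T₂)))
    (hz₀ : 25 ≤ 1 / (4 * T₂)) (hE₂ : 128 / (3 * c₀) * 25 ^ 2 ≤ Real.exp 25) :
    1 / (6 * T ^ 2) * Real.exp (4 * u) * Real.exp (-Q / (4 * T)) ≤ c₀ := by
  have hr0 : 0 < Real.exp u := Real.exp_pos u
  have hT₂0 : 0 < T₂ := hT.trans_le hT₂
  have h4u : Real.exp (4 * u) = Real.exp u ^ 4 := by rw [← Real.exp_nat_mul]; norm_num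
  rcases le_or_gt (Real.exp u) 2 with hle | hgt
  · set x : ℝ := q₀ / (4 * T) with hx
    have hxx₀ : q₀ / (4 * T₂) ≤ x := by
      rw [hx]; exact div_le_div_of_nonneg_left hq₀.le (by positivity) (by linarith)
    have hex : 128 / (3 * c₀ * q₀ ^ 2) * x ^ 2 ≤ Real.exp x :=
      certMidLow3_sq_le_exp (by positivity) hx₀ hE₁ hxx₀
    have h16 : Real.exp (4 * u) ≤ 16 := by
      rw [h4u]; exact (pow_le_pow_left₀ hr0.le hle 4).trans (by norm_num)
    have hE : Real.exp (-Q / (4 * T)) ≤ (Real.exp x)⁻¹ := by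
      rw [← Real.exp_neg]
      apply Real.exp_le_exp.2
      rw [hx, neg_div, neg_le_neg_iff]
      exact div_le_div_of_nonneg_right hQ2.le (by positivity)
    have hkey : 8 / (3 * c₀) ≤ T ^ 2 * Real.exp x := by
      have h1 : T ^ 2 * (128 / (3 * c₀ * q₀ ^ 2) * x ^ 2) = 8 / (3 * c₀) := by
        rw [hx]; field_simp; ring
      rw [← h1]
      exact mul_le_mul_of_nonneg_left hex (sq_nonneg T)
    have hTe : 0 < T ^ 2 * Real.exp x := by positivity
    calc 1 / (6 * T ^ 2) * Real.exp (4 * u) * Real.exp (-Q / (4 * T))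
        ≤ 1 / (6 * T ^ 2) * 16 * (Real.exp x)⁻¹ := by gcongr
      _ = 8 / 3 / (T ^ 2 * Real.exp x) := by field_simp; ring
      _ ≤ 8 / 3 / (8 / (3 * c₀)) := by gcongr
      _ = c₀ := by field_simp
  · set r := Real.exp u with hr
    have hprod : 0 ≤ (r - 2) * (3 * r - 2) := mul_nonneg (by linarith) (by linarith)
    have hQr : r ^ 2 / 4 ≤ Q := by nlinarith [hprod, hQ1]
    set z : ℝ := r ^ 2 / (16 * T) with hz
    have hz25 : 25 ≤ z := by
      rw [hz]
      calc (25 : ℝ) ≤ 1 / (4 * T₂) := hz₀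
        _ ≤ 1 / (4 * T) := div_le_div_of_nonneg_left zero_le_one (by positivity) (by linarith)
        _ = 4 / (16 * T) := by field_simp; norm_num
        _ ≤ r ^ 2 / (16 * T) := div_le_div_of_nonneg_right (by nlinarith) (by positivity)
    have hez : 128 / (3 * c₀) * z ^ 2 ≤ Real.exp z :=
      certMidLow3_sq_le_exp (by positivity) (by norm_num) hE₂ hz25
    have hE : Real.exp (-Q / (4 * T)) ≤ (Real.exp z)⁻¹ := by
      rw [← Real.exp_neg]
      apply Real.exp_le_exp.2
      rw [hz, neg_div, neg_le_neg_iff, div_le_div_iff₀ (by positivity) (by positivity)]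
      nlinarith [hQr, hT]
    have hr4 : r ^ 4 = 256 * T ^ 2 * z ^ 2 := by rw [hz]; field_simp; ring
    have hzpos : 0 < Real.exp z := Real.exp_pos z
    calc 1 / (6 * T ^ 2) * Real.exp (4 * u) * Real.exp (-Q / (4 * T))
        ≤ 1 / (6 * T ^ 2) * r ^ 4 * (Real.exp z)⁻¹ := by rw [h4u]; gcongr
      _ = 128 / 3 * z ^ 2 / Real.exp z := by rw [hr4]; field_simp; ring
      _ ≤ 128 / 3 * z ^ 2 / (128 / (3 * c₀) * z ^ 2) := by gcongr
      _ = c₀ := by field_simp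

/-- Chord minorant of the concave `T ↦ log(6cT²)` on `[T₁, T₂]`: an affine function below it at the two
endpoints is below it on the whole interval. [folklore] -/
theorem certMidLow3_logchord {T T₁ T₂ a₀ b₀ c : ℝ} (hT₁ : 0 < T₁) (h12 : T₁ < T₂) (hc : 0 < c)
    (h1 : a₀ + b₀ * T₁ ≤ Real.log (6 * T₁ ^ 2 * c)) (h2 : a₀ + b₀ * T₂ ≤ Real.log (6 * T₂ ^ 2 * c))
    (hT1 : T₁ ≤ T) (hT2 : T ≤ T₂) : a₀ + b₀ * T ≤ Real.log (6 * T ^ 2 * c) := by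
  have hT : 0 < T := hT₁.trans_le hT1
  have hT₂ : 0 < T₂ := hT₁.trans h12
  set t : ℝ := (T - T₁) / (T₂ - T₁) with ht
  have hba : 0 < T₂ - T₁ := by linarith
  have ht0 : 0 ≤ t := div_nonneg (by linarith) hba.le
  have ht1 : t ≤ 1 := by rw [ht, div_le_one hba]; linarith
  have hconc := (strictConcaveOn_log_Ioi.concaveOn).2 (Set.mem_Ioi.2 hT₁) (Set.mem_Ioi.2 hT₂)
    (show (0 : ℝ) ≤ 1 - t by linarith) ht0 (by ring)
  simp only [smul_eq_mul] at hconc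
  have hTt : (1 - t) * T₁ + t * T₂ = T := by rw [ht]; field_simp; ring
  rw [hTt] at hconc
  have hlog : ∀ x : ℝ, 0 < x → Real.log (6 * x ^ 2 * c) = Real.log (6 * c) + 2 * Real.log x := by
    intro x hx
    rw [show 6 * x ^ 2 * c = (6 * c) * x ^ 2 by ring, Real.log_mul (by positivity) (by positivity),
      Real.log_pow]; norm_num
  rw [hlog T₁ hT₁] at h1
  rw [hlog T₂ hT₂] at h2
  rw [hlog T hT]
  have haff : a₀ + b₀ * T = (1 - t) * (a₀ + b₀ * T₁) + t * (a₀ + b₀ * T₂) := by rw [ht]; field_simp; ring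
  rw [haff]
  nlinarith [mul_le_mul_of_nonneg_left h1 (show (0 : ℝ) ≤ 1 - t by linarith),
    mul_le_mul_of_nonneg_left h2 ht0]

/-- **Registered helper sub-goal `helper_certMidLow3Rule`**: the blending rule `certMidLow3_rule` in
`∀`-form. [folklore] -/
theorem helper_certMidLow3Rule : ∀ (T u s Q c L Hc l0 l1 l2 l3 k₁ σ₁ ℓ₁ w₁ k₂ σ₂ ℓ₂ w₂ k₃ σ₃ ℓ₃ w₃ : ℝ), 0 < T → 0 < k₁ → 0 < k₂ → 0 < k₃ →
    -1 ≤ s → s ≤ 1 → k₁ ^ 2 * Real.exp ℓ₁ = w₁ → k₂ ^ 2 * Real.exp ℓ₂ = w₂ → k₃ ^ 2 * Real.exp ℓ₃ = w₃ → 0 <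
    c → L ≤ Real.log (6 * T ^ 2 * c) → 0 ≤ l0 → 0 ≤ l1 → 0 ≤ l2 → 0 ≤ l3 → l0 + l1 + l2 + l3 = 1 → Hc ≤ -(l0
    * Real.log l0 + l1 * Real.log l1 + l2 * Real.log l2 + l3 * Real.log l3) → k₁ * k₂ * k₃ * (16 * T * u -
    Q) ≤ 4 * T * k₁ * k₂ * k₃ * (Hc + l0 * L + l1 * ℓ₁ + l2 * ℓ₂ + l3 * ℓ₃) - l1 * k₂ * k₃ * (Real.arccos s
    ^ 2 + (u - σ₁) ^ 2) - l2 * k₁ * k₃ * (Real.arccos s ^ 2 + (u - σ₂) ^ 2) - l3 * k₁ * k₂ * (Real.arccos s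
    ^ 2 + (u - σ₃) ^ 2) → (8 * Real.pi ^ 2 / 3) * ((4 * Real.pi * T) ^ 2)⁻¹ * Real.exp (4 * u) * Real.exp
    (-Q / (4 * T)) ≤ w₁ * (zonal (k₁ * T) s * Real.exp (-(u - σ₁) ^ 2 / (4 * (k₁ * T)))) + w₂ * (zonal (k₂ *
    T) s * Real.exp (-(u - σ₂) ^ 2 / (4 * (k₂ * T)))) + w₃ * (zonal (k₃ * T) s * Real.exp (-(u - σ₃) ^ 2 /
    (4 * (k₃ * T)))) + c :=
  fun _ _ _ _ _ _ _ _ _ _ _ _ _ _ _ _ _ _ _ _ _ _ _ hT hk₁ hk₂ hk₃ hs1 hs2 hw₁ hw₂ hw₃ hc hL h0 h1 h2 h3 hsum hH hpoly =>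
    certMidLow3_rule hT hk₁ hk₂ hk₃ hs1 hs2 hw₁ hw₂ hw₃ hc hL h0 h1 h2 h3 hsum hH hpoly

end Summit.SmoothPoincare4.SmoothPoincare4.Theorems.CylinderEntropySliceIsolation

end
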